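import Literature.AlgebraicGeometry.Motives.EllAdicCohomologyFinitenessFromProducts
import Literature.AlgebraicGeometry.Motives.ProetLimOneSequenceProofs
import Literature.AlgebraicGeometry.Motives.EtaleToProetExt
import Literature.AlgebraicGeometry.Motives.EtaleToProetLanProofs
import HarnessLib

/-!
# Finiteness of `ℓ`-adic cohomology, VII bis: the discharges now available

`EllAdicCohomologyFinitenessFromProducts.lean` proves every finiteness fact of the `ℓ`-adic
cluster from `bijective_piComparison_proetCohomology` (Bhatt–Scholze Prop. 3.1.9: countable
products are exact on `Y_proét`) together with the pro-étale finiteness fact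
`finite_proetCohomology_zmod_of_isProper` (Milne VI Cor. 2.8 read on `Y_proét`). Since then
`bijective_piComparison_proetCohomology_holds` (`ProetLimOneSequenceProofs.lean`) and
`full_faithful_etaleToProetPullback_holds` (`EtaleToProetLanProofs.lean`, Bhatt–Scholze
Lemma 5.1.2) have been proved. This file records what follows, with no new named fact:

* `exists_module_finite_ellAdicCohomology_of_finite_holds` — **discharge** of the named fact
  `exists_module_finite_ellAdicCohomology_of_finite` (`EllAdicCohomologyFiniteness.lean`): for `Y`
  locally Noetherian with all `Hʲ(Y_proét, ℤ/ℓᵐ)` finite, `Hⁱ_proét(Y, ℤ_ℓ)` is a finitely generated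
  `ℤ_ℓ`-module (Milne V Lemma 1.11 + the pro-étale `lim¹` sequence, both proved);
* `exists_module_finite_ellAdicCohomology_of_isProper_of_zmod_finite`,
  `exists_addEquiv_geometricEllAdicCohomology_of_zmod_finite` — the module-level finiteness of
  `Hⁱ_proét(Y, ℤ_ℓ)` for `Y` proper over a separably closed field (Milne V.1.11 with VI.2.8; a
  composite, stated as an explicit conclusion, not a named fact, D-0026) and the remaining finiteness
  fact `exists_addEquiv_geometricEllAdicCohomology k` now rest on `finite_proetCohomology_zmod_of_isProper`
  ALONE;
* `finite_proetCohomology_zmod_of_isProper_of_etale_finite_of_acyclic` and the two corollaries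
  after it — equivalently on {`finite_etaleCohomology_of_isProper` (Milne VI Cor. 2.8 on `Y_ét`,
  the proper base change / finiteness theorem), the acyclicity of `ν*I` for injective `I` (the
  proof of Bhatt–Scholze Cor. 5.1.6; the explicit hypothesis `hc`, spelled out verbatim — formerly
  the named fact `subsingleton_sheafH_etaleToProetPullback_injective` of `EtaleToProetExt.lean`,
  merged back into Cor. 5.1.6 under D-0026 as its residual proof obligation)}.
* `nonempty_addEquiv_sheafH_etaleToProetPullback_of_acyclic`,
  `nonempty_addEquiv_constantSheafH_proet_etale_of_acyclic`,
  `nonempty_addEquiv_proetCohomology_etaleCohomology_of_acyclic` — the comparison statements of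
  the cluster (the named fact Bhatt–Scholze Cor. 5.1.6 as `Hⁱ(X_ét, F) ≅ Hⁱ(X_proét, ν*F)`,
  `EtaleToProet.lean`; its constant-sheaf case `Hⁱ(X_proét, M_X) ≅ Hⁱ(X_ét, M_X)`, an explicit
  conclusion and not a separate named fact (D-0026); the named bridge fact
  `Hⁱ(Y_proét, ℤ/n) ≅ Hⁱ(Y_ét, ℤ/n)`, `EllAdicCohomologyFinitenessEtale.lean`) each follow from
  the acyclicity of `ν*I` alone, Lemma 5.1.2 being proved: none of
  them is an independent assumption any more, and each is discharged by one line once the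
  acyclicity of `ν*I` is. What that acyclicity needs beyond the tree is exactly the two inputs of
  the printed proof of Cor. 5.1.6 (arXiv p. 30): the cofinality of ind-étale covers among the
  pro-étale covers of a pro-étale affine (Thm. 2.3.4, proved from Olivier's Thm. 2.3.5 and the
  w-strictly local covers of Lemmas 2.3.7–2.3.8, pp. 11–12; on Mathlib's carriers this is
  Lemma 4.2.4, the named fact `isCoverDense_proetAffineInclusion`), and the Čech criterion
  "[SGA4, V]" turning `Ȟᵖ = 0` on such covers into `Hᵖ = 0` for `Sheaf.H`. Mathlib has the Čech
  complex of a family (`CategoryTheory/Sites/SheafCohomology/Cech.lean`) but no comparison with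
  `Sheaf.H`, and weakly étale algebras (`RingTheory/Etale/Weakly.lean`) but neither ind-étale
  structure theory nor strict henselisation.

## References

* J. S. Milne, *Étale cohomology* (2025 reissue, held copy; PDF pages): V Lemma 1.11 p. 177;
  VI Cor. 2.8 p. 238 (proof: VI Thm. 2.1, pp. 236–). [Milne2025]
* B. Bhatt, P. Scholze, *The pro-étale topology for schemes*, Astérisque 369 (2015)
  (arXiv:1309.1198; arXiv pages): Thm. 2.3.4–2.3.5 and Lemmas 2.3.7–2.3.8 (pp. 11–12),
  Prop. 3.1.9–3.1.10 (pp. 15–16), Lemma 4.2.4 (p. 24), Lemma 5.1.2, Cor. 5.1.6 and its proof,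
  Cor. 5.1.9 (pp. 29–30), Prop. 5.6.2 (p. 34). [BhattScholze2015]

## Design notes

* Leaf file: imports the statement file `EllAdicCohomologyFinitenessFromProducts.lean` and the two
  discharge files; nothing imports it. Theorems only (one-line applications of accepted glue).
* `lean search` / tree grep: no `exists_module_finite_ellAdicCohomology_of_finite_holds` elsewhere
  (`EllAdicCohomologyOfFiniteReduction.lean` proves the fact only conditionally on
  `ellAdicCohomology_limOneSequence` and the Cor. 5.1.6 bridge).
-/

universe u

open CategoryTheory AlgebraicGeometry

namespace Literature.AlgebraicGeometry.Motives

/-! ### The discharge -/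

/-- **Discharge of `exists_module_finite_ellAdicCohomology_of_finite`** (Milne V Lemma 1.11 for
`Hⁱ_proét(Y, ℤ_ℓ)`, via the pro-étale `lim¹` sequence): for a locally Noetherian scheme `Y` and a
prime `ℓ` with all `Hʲ(Y_proét, ℤ/ℓᵐ)` finite, every `Hⁱ_proét(Y, ℤ_ℓ)` carries a `ℤ_ℓ`-module
structure for which it is finitely generated. Proof: the reduction to
`bijective_piComparison_proetCohomology` (`exists_module_finite_ellAdicCohomology_of_finite_of_piComparison`,
with the canonical module structure `ellAdicCohomologyModule`) and its discharge
`bijective_piComparison_proetCohomology_holds`. [cite: Milne2025, V Lemma 1.11]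
[cite: BhattScholze2015, Prop. 3.1.9–3.1.10 and Prop. 5.6.2] -/
theorem exists_module_finite_ellAdicCohomology_of_finite_holds :
    exists_module_finite_ellAdicCohomology_of_finite.{u} :=
  exists_module_finite_ellAdicCohomology_of_finite_of_piComparison
    bijective_piComparison_proetCohomology_holds

/-! ### The remaining facts of the cluster rest on `finite_proetCohomology_zmod_of_isProper` alone -/

/-- **Finite generation of `Hⁱ_proét(Y, ℤ_ℓ)` over `ℤ_ℓ` for proper `Y`, from
`finite_proetCohomology_zmod_of_isProper` alone**: for `Y` proper over a separably closed field,
`Hⁱ_proét(Y, ℤ_ℓ)` (Mathlib's `Scheme.EllAdicCohomology Y ℓ i`) carries a `ℤ_ℓ`-module structure for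
which it is finitely generated as soon as all `Hʲ(Y_proét, ℤ/n)` (`n ≥ 1`) are finite (Milne V Lemma 1.11,
proved, with VI Cor. 2.8 as the hypothesis; the composite conclusion is spelled out, not a named fact,
D-0026). [cite: Milne2025, V Lemma 1.11 and VI Cor. 2.8] -/
theorem exists_module_finite_ellAdicCohomology_of_isProper_of_zmod_finite
    (hB : finite_proetCohomology_zmod_of_isProper.{u}) :
    ∀ ⦃K : Type u⦄ [Field K] [IsSepClosed K] ⦃Y : Scheme.{u}⦄ (f : Y ⟶ Spec (CommRingCat.of K))
      [IsProper f] (ℓ : ℕ) [Fact ℓ.Prime] (i : ℕ),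
      ∃ _ : Module ℤ_[ℓ] (Y.EllAdicCohomology ℓ i), Module.Finite ℤ_[ℓ] (Y.EllAdicCohomology ℓ i) :=
  exists_module_finite_ellAdicCohomology_of_isProper_of_finite_of_piComparison hB
    bijective_piComparison_proetCohomology_holds

/-- **`exists_addEquiv_geometricEllAdicCohomology k` from `finite_proetCohomology_zmod_of_isProper`
alone**: for `X` smooth projective geometrically irreducible over any field `k`, every prime `ℓ`
and every `i`, `Hⁱ_proét(X_{k̄}, ℤ_ℓ) ≃+ ℤ_ℓ^b × T` with `T` finite, conditionally only on the
finiteness of the `Hʲ(Y_proét, ℤ/n)` for `Y` proper over a separably closed field (Milne VI Cor. 2.8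
read on the pro-étale site). This is the whole residual proof obligation of the named fact
`exists_addEquiv_geometricEllAdicCohomology`. [cite: Milne2025, V Lemma 1.11 and VI Cor. 2.8]
[cite: BhattScholze2015, Prop. 3.1.9–3.1.10] -/
theorem exists_addEquiv_geometricEllAdicCohomology_of_zmod_finite
    (hB : finite_proetCohomology_zmod_of_isProper.{u}) (k : Type u) [Field k] :
    exists_addEquiv_geometricEllAdicCohomology k :=
  exists_addEquiv_geometricEllAdicCohomology_of_finite_of_piComparison hB
    bijective_piComparison_proetCohomology_holds k

/-! ### Equivalently: on Milne VI Cor. 2.8 (étale site) and the acyclicity of `ν*I` -/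

/-- **`finite_proetCohomology_zmod_of_isProper` from Milne VI Cor. 2.8 on `Y_ét` and the acyclicity of
`ν*I` on `Y_proét`** (the proof of Bhatt–Scholze Cor. 5.1.6), full faithfulness of `ν*`
(Lemma 5.1.2) being proved (`full_faithful_etaleToProetPullback_holds`).
[cite: Milne2025, VI Cor. 2.8] [cite: BhattScholze2015, Cor. 5.1.6 and Lemma 5.1.2] -/
theorem finite_proetCohomology_zmod_of_isProper_of_etale_finite_of_acyclic
    (h₂ : finite_etaleCohomology_of_isProper.{u})
    (hc : ∀ (X : Scheme.{u}) (I : Sheaf X.smallEtaleTopology Ab.{u}), Injective I →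
      ∀ p : ℕ, Subsingleton (((etaleToProetPullbackULift X).obj I).H (p + 1))) :
    finite_proetCohomology_zmod_of_isProper.{u} :=
  finite_proetCohomology_zmod_of_isProper_of_etale_site_facts h₂
    full_faithful_etaleToProetPullback_holds hc

/-- Hence the module-level finiteness of `Hⁱ_proét(Y, ℤ_ℓ)`, `Y` proper over a separably closed
field, from {Milne VI Cor. 2.8 on `Y_ét`, acyclicity of `ν*I`}.
[cite: Milne2025, V Lemma 1.11 and VI Cor. 2.8] [cite: BhattScholze2015, Cor. 5.1.6] -/
theorem exists_module_finite_ellAdicCohomology_of_isProper_of_etale_finite_of_acyclic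
    (h₂ : finite_etaleCohomology_of_isProper.{u})
    (hc : ∀ (X : Scheme.{u}) (I : Sheaf X.smallEtaleTopology Ab.{u}), Injective I →
      ∀ p : ℕ, Subsingleton (((etaleToProetPullbackULift X).obj I).H (p + 1))) :
    ∀ ⦃K : Type u⦄ [Field K] [IsSepClosed K] ⦃Y : Scheme.{u}⦄ (f : Y ⟶ Spec (CommRingCat.of K))
      [IsProper f] (ℓ : ℕ) [Fact ℓ.Prime] (i : ℕ),
      ∃ _ : Module ℤ_[ℓ] (Y.EllAdicCohomology ℓ i), Module.Finite ℤ_[ℓ] (Y.EllAdicCohomology ℓ i) :=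
  exists_module_finite_ellAdicCohomology_of_isProper_of_zmod_finite
    (finite_proetCohomology_zmod_of_isProper_of_etale_finite_of_acyclic h₂ hc)

/-- Hence `exists_addEquiv_geometricEllAdicCohomology k` from {Milne VI Cor. 2.8 on `Y_ét`
(`finite_etaleCohomology_of_isProper`), acyclicity of `ν*I` (hypothesis `hc`, the proof of
Cor. 5.1.6)}: the current trust base of the fact.
[cite: Milne2025, V Lemma 1.11 and VI Cor. 2.8] [cite: BhattScholze2015, Cor. 5.1.6 and Prop. 3.1.9] -/
theorem exists_addEquiv_geometricEllAdicCohomology_of_etale_finite_of_acyclic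
    (h₂ : finite_etaleCohomology_of_isProper.{u})
    (hc : ∀ (X : Scheme.{u}) (I : Sheaf X.smallEtaleTopology Ab.{u}), Injective I →
      ∀ p : ℕ, Subsingleton (((etaleToProetPullbackULift X).obj I).H (p + 1)))
    (k : Type u) [Field k] :
    exists_addEquiv_geometricEllAdicCohomology k :=
  exists_addEquiv_geometricEllAdicCohomology_of_zmod_finite
    (finite_proetCohomology_zmod_of_isProper_of_etale_finite_of_acyclic h₂ hc) k

/-! ### The three comparison facts rest on the acyclicity of `ν*I` alone -/

/-- **Bhatt–Scholze Cor. 5.1.6 on Mathlib's carriers from the acyclicity of `ν*I` alone**: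
`Hⁱ(X_ét, F) ≅ Hⁱ(X_proét, ν*F)` for every abelian étale sheaf `F`
(`nonempty_addEquiv_sheafH_etaleToProetPullback`, `EtaleToProet.lean`) follows from
the acyclicity `Hᵖ⁺¹(X_proét, ν*I) = 0` (`I` injective on `X_ét`), the other input of
`nonempty_addEquiv_sheafH_etaleToProetPullback_of_facts` — full faithfulness of `ν*`, Lemma 5.1.2 —
being proved (`full_faithful_etaleToProetPullback_holds`). The hypothesis is the residual proof
obligation of Cor. 5.1.6 itself (conversely Cor. 5.1.6 implies it:
`Hᵖ⁺¹(X_proét, ν*I) ≅ Hᵖ⁺¹(X_ét, I) = Extᵖ⁺¹(ℤ_X, I) = 0`). [cite: BhattScholze2015, Cor. 5.1.6] -/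
theorem nonempty_addEquiv_sheafH_etaleToProetPullback_of_acyclic
    (hc : ∀ (X : Scheme.{u}) (I : Sheaf X.smallEtaleTopology Ab.{u}), Injective I →
      ∀ p : ℕ, Subsingleton (((etaleToProetPullbackULift X).obj I).H (p + 1))) :
    nonempty_addEquiv_sheafH_etaleToProetPullback.{u} :=
  nonempty_addEquiv_sheafH_etaleToProetPullback_of_facts full_faithful_etaleToProetPullback_holds hc

/-- **The constant-sheaf comparison `Hⁱ(X_proét, M_X) ≅ Hⁱ(X_ét, M_X)` (Bhatt–Scholze Cor. 5.1.9 /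
5.1.6 for constant sheaves: coefficients `ULift M ∈ Ab.{u+1}` on `X.ProEt`, `ULift M ∈ Ab.{u}` on
`X.Etale`, `Hⁱ = Sheaf.H`) from the acyclicity of `ν*I` alone**, through
`nonempty_addEquiv_constantSheafH_proet_etale_of_pullback` (`EtaleToProet.lean`). Stated as an
explicit conclusion: the constant-sheaf case is Cor. 5.1.6 specialised and carries no proof
obligation of its own (D-0026). [cite: BhattScholze2015, Cor. 5.1.9 and Cor. 5.1.6] -/
theorem nonempty_addEquiv_constantSheafH_proet_etale_of_acyclic
    (hc : ∀ (X : Scheme.{u}) (I : Sheaf X.smallEtaleTopology Ab.{u}), Injective I →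
      ∀ p : ℕ, Subsingleton (((etaleToProetPullbackULift X).obj I).H (p + 1)))
    (X : Scheme.{u}) (M : Type)
    [AddCommGroup M] (i : ℕ) :
    Nonempty
      (((constantSheaf (Scheme.ProEt.topology X) Ab.{u + 1}).obj
          (AddCommGrpCat.of (ULift.{u + 1} M))).H i ≃+
        (((constantSheaf X.smallEtaleTopology Ab.{u}).obj (AddCommGrpCat.of (ULift.{u} M))).H i :
          Type u)) :=
  nonempty_addEquiv_constantSheafH_proet_etale_of_pullback
    (nonempty_addEquiv_sheafH_etaleToProetPullback_of_acyclic hc) X M i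

/-- **The bridge `Hⁱ(Y_proét, ℤ/n) ≅ Hⁱ(Y_ét, ℤ/n)` (Cor. 5.1.6 with Lemma 4.2.12,
`nonempty_addEquiv_proetCohomology_etaleCohomology`, `EllAdicCohomologyFinitenessEtale.lean`) from
the acyclicity of `ν*I` alone**: the whole residual proof obligation of the bridge fact is the
hypothesis `hc` (the proof of Cor. 5.1.6).
[cite: BhattScholze2015, Cor. 5.1.6 and Lemma 4.2.12] -/
theorem nonempty_addEquiv_proetCohomology_etaleCohomology_of_acyclic
    (hc : ∀ (X : Scheme.{u}) (I : Sheaf X.smallEtaleTopology Ab.{u}), Injective I →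
      ∀ p : ℕ, Subsingleton (((etaleToProetPullbackULift X).obj I).H (p + 1))) :
    nonempty_addEquiv_proetCohomology_etaleCohomology.{u} :=
  nonempty_addEquiv_proetCohomology_etaleCohomology_of_etale_site_facts
    full_faithful_etaleToProetPullback_holds hc

end Literature.AlgebraicGeometry.Motives
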